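import Summits.BirchSwinnertonDyer.Rank1Residual.GaloisImage.LocalThreeTorsionAdicCompletion
import Summits.BirchSwinnertonDyer.Rank1Residual.GaloisImage.LocalThreeTorsionDeciderAt
import Literature.NumberTheory.EllipticCurves.IsogenyFrobeniusTraceProofs
import HarnessLib

/-!
# The local `3`-torsion count at a place `v ∤ 3`, visibility currency: `#E(ℚ_v)[3]` as a KERNEL
# number from the `ℓ ≠ 3` decider `threeTorsionCheckAt` (team n1011, row T-LOC3L, FILE L5 —
# the `v ∤ 3` twin of p18's `LocalThreeTorsionAdicCompletion` §3)

HONEST FRAMING (cell `b2b-bsdres`, run/shared/lean/b2b/bsd-rank1-residual/, verbatim in every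
file): the goal of the cell is to DELETE the COMBINATION-SHAPED residual classes of the
Birch–Swinnerton-Dyer formula for ALL analytic-rank `≤ 1` elliptic curves over `ℚ` — "full BSD
formula for every rank `≤ 1` curve in class `C`" assembled STRICTLY from published theorems — so
that the rank-`≤ 1` remainder becomes exactly the CONSTRUCTION-SHAPED classes, which are TYPED
(missing-input `Prop`s), NOT attempted. This is not "finishing BSD". Team n1011 (N10/N11 = X4 ∧
`p = 3`, research route; ROW T-VIS3 = the visible / congruence LOWER bound at additive `3`). THIS
FILE IS A TOOL: theorems only (no definition, no named fact, no `sorry`); it closes nothing, books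
nothing, moves no mark / label / count.

## What

p04's refined visibility certificate `Visible.sq_dvd_card_sha_three_of_congr_of_places`
(`GaloisImage/VisibleLowerBoundThree.lean`) lets a place `w ∈ S \ T`, `w ∤ 3`, go FREE when
(i) `((3 : ℕ) : 𝓞 ℚ) ∉ w.asIdeal ∧ #ker([3] : E′(ℚ_w)) = 1`, or (ii) both curves split
multiplicative at `w` with `#ker([3] : E(ℚ_w)) ≤ 3`, or (iii) a twist-class condition. The two
NUMERALS of (i) and (ii) are local `3`-torsion counts at `w ≠ 3`; this file reads them off the
kernel decider `LocalTorsion3At.threeTorsionCheckAt` (FILE L3) through p18's currency bridge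
`LocalTorsion3.natCard_ker_nsmul_adicCompletion_eq_natCard_torsion_padic` (generic `p`, `n`):

* `natCard_ker_nsmul_three_adicCompletion_eq_of_checkAt` — `#ker([3] : E(ℚ_v)) = 1 + 2S` at a place
  `v` over a prime `p ≠ 3` with `threeTorsionCheckAt p a₁ … a₆ k cert = some S`, for any `W/ℚ`
  with `W = ⟨a₁, …, a₆⟩` (record binder shape) — and the `integralModelInt` twin;
* `free_kind_i_of_checkAt` — `S = 0` gives clause (i) LITERALLY:
  `((3 : ℕ) : 𝓞 ℚ) ∉ v.asIdeal ∧ #ker([3] : E′(ℚ_v)) = 1`;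
* `natCard_ker_nsmul_three_adicCompletion_le_three_of_checkAt` — `S = 1` gives the numeral of
  clause (ii): `#ker([3] : E(ℚ_v)) ≤ 3` (the only tree route to it where `3`-torsion IS present:
  split multiplicative `w ≡ 1 (mod 3)`, `μ₃ ⊂ ℚ_w`, `#E(ℚ_w)[3] = 3` exactly).

Certificates `(k, cert)` per (curve, place): `HOME/b2b-bsdres-n1011-p17/census/T-LOC3T-V40-CERTS.md`
(201 (curve, w ≠ 3) pairs of r1's V40 list; found by `census/loc3l_cert.py`, checked in the kernel
by `decide +kernel` only when a record invokes these theorems). Two demo instances: 2718f1 at the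
place of 151 (non-split `I₁`, `S = 0`: clause (i)) and 6867e1 at the place of 7 (split, `7 ≡ 1
(mod 3)`, `S = 1`: the numeral of clause (ii)).

NOT claimed: reduction-type predicates of clauses (ii)/(iii), the twist-class and `μ₃` conditions of
(iii), any congruence, rank certificate or record. References: [SilvermanAEC2009] VII.3, Ex. 3.7;
[Serre1973] Ch. II §3.3; [CremonaMazur2000] §3, Table 1; [Cremona2006] (labels, models).
-/

set_option autoImplicit false

noncomputable section

open scoped Classical NumberField
open IsDedekindDomain NumberField WeierstrassCurve Rat.HeightOneSpectrum
open Summit.BirchSwinnertonDyer.Rank1Residual.GaloisImage.LocalTorsion3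
  (natCard_ker_nsmul_adicCompletion_eq_natCard_torsion_padic)

namespace Summit.BirchSwinnertonDyer.Rank1Residual.GaloisImage.LocalTorsion3At

section Bridge

variable (p : ℕ) [hp : Fact p.Prime] (a₁ a₂ a₃ a₄ a₆ : ℤ)

/-- **`#ker([3] : E(ℚ_v)) = 1 + 2S` at a place `v ∤ 3` from the decider**: for a prime `p ≠ 3`,
integers `a₁, …, a₆` with `Δ ≠ 0` and `threeTorsionCheckAt p a₁ a₂ a₃ a₄ a₆ k cert = some S`, the
kernel of `[3]` on the `ℚ_v`-points (`v` the place of `p`) of any `W/ℚ` with `W = ⟨a₁, …, a₆⟩` has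
`1 + 2S` elements. [cite: SilvermanAEC2009, VII.3.1 and Ex. 3.7] -/
theorem natCard_ker_nsmul_three_adicCompletion_eq_of_checkAt (hp3 : p ≠ 3)
    (hΔ : (⟨a₁, a₂, a₃, a₄, a₆⟩ : WeierstrassCurve ℤ).Δ ≠ 0) {k S : ℕ}
    {cert : List (ℤ × ℕ × ℕ × ℕ)} (h : threeTorsionCheckAt p a₁ a₂ a₃ a₄ a₆ k cert = some S)
    (W : WeierstrassCurve ℚ) (hW : W = ⟨a₁, a₂, a₃, a₄, a₆⟩)
    {v : HeightOneSpectrum (𝓞 ℚ)} (hv : (primesEquiv v : ℕ) = p) :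
    Nat.card (nsmulAddMonoidHom 3 : (W.baseChange (v.adicCompletion ℚ)).toAffine.Point →+
      (W.baseChange (v.adicCompletion ℚ)).toAffine.Point).ker = 1 + 2 * S := by
  subst hW
  rw [natCard_ker_nsmul_adicCompletion_eq_natCard_torsion_padic _ v hv 3]
  exact natCard_threeTorsion_padic_eq_of_check p a₁ a₂ a₃ a₄ a₆ hp3 hΔ h

omit hp in
/-- The place of a prime `p ≠ 3` does not contain `3`. [folklore] -/
theorem three_notMem_asIdeal_of_primesEquiv_eq (hp3 : p ≠ 3) {v : HeightOneSpectrum (𝓞 ℚ)}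
    (hv : (primesEquiv v : ℕ) = p) : ((3 : ℕ) : 𝓞 ℚ) ∉ v.asIdeal :=
  natCast_not_mem_asIdeal_of_primesEquiv_ne Nat.prime_three (by rw [hv]; exact hp3)

/-- **Free kind (i) of `sq_dvd_card_sha_three_of_congr_of_places`, LITERALLY, from the decider**
(`S = 0`): `((3 : ℕ) : 𝓞 ℚ) ∉ v.asIdeal ∧ #ker([3] : E′(ℚ_v)) = 1` for the partner `E′ = ⟨a₁, …, a₆⟩`
at the place `v` of a prime `p ≠ 3` with `threeTorsionCheckAt p a₁ … a₆ k cert = some 0`.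
[cite: SilvermanAEC2009, VII.3.1 and Ex. 3.7] -/
theorem free_kind_i_of_checkAt (hp3 : p ≠ 3)
    (hΔ : (⟨a₁, a₂, a₃, a₄, a₆⟩ : WeierstrassCurve ℤ).Δ ≠ 0) {k : ℕ}
    {cert : List (ℤ × ℕ × ℕ × ℕ)} (h : threeTorsionCheckAt p a₁ a₂ a₃ a₄ a₆ k cert = some 0)
    (E' : WeierstrassCurve ℚ) (hE' : E' = ⟨a₁, a₂, a₃, a₄, a₆⟩)
    {v : HeightOneSpectrum (𝓞 ℚ)} (hv : (primesEquiv v : ℕ) = p) :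
    ((3 : ℕ) : 𝓞 ℚ) ∉ v.asIdeal ∧
      Nat.card (nsmulAddMonoidHom 3 : (E'.baseChange (v.adicCompletion ℚ)).toAffine.Point →+
        (E'.baseChange (v.adicCompletion ℚ)).toAffine.Point).ker = 1 := by
  refine ⟨three_notMem_asIdeal_of_primesEquiv_eq p hp3 hv, ?_⟩
  rw [natCard_ker_nsmul_three_adicCompletion_eq_of_checkAt p a₁ a₂ a₃ a₄ a₆ hp3 hΔ h E' hE' hv]

/-- **The numeral of free kind (ii), from the decider** (`S = 1`): `#ker([3] : E(ℚ_v)) ≤ 3` for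
`W = ⟨a₁, …, a₆⟩` at the place `v` of a prime `p ≠ 3` with
`threeTorsionCheckAt p a₁ … a₆ k cert = some 1` (split multiplicative `p ≡ 1 (mod 3)`: the count is
exactly `3`). [cite: SilvermanAEC2009, VII.3.1 and Ex. 3.7] -/
theorem natCard_ker_nsmul_three_adicCompletion_le_three_of_checkAt (hp3 : p ≠ 3)
    (hΔ : (⟨a₁, a₂, a₃, a₄, a₆⟩ : WeierstrassCurve ℤ).Δ ≠ 0) {k : ℕ}
    {cert : List (ℤ × ℕ × ℕ × ℕ)} (h : threeTorsionCheckAt p a₁ a₂ a₃ a₄ a₆ k cert = some 1)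
    (W : WeierstrassCurve ℚ) (hW : W = ⟨a₁, a₂, a₃, a₄, a₆⟩)
    {v : HeightOneSpectrum (𝓞 ℚ)} (hv : (primesEquiv v : ℕ) = p) :
    Nat.card (nsmulAddMonoidHom 3 : (W.baseChange (v.adicCompletion ℚ)).toAffine.Point →+
      (W.baseChange (v.adicCompletion ℚ)).toAffine.Point).ker ≤ 3 := by
  rw [natCard_ker_nsmul_three_adicCompletion_eq_of_checkAt p a₁ a₂ a₃ a₄ a₆ hp3 hΔ h W hW hv]

/-- A `some 0` check also gives the `≤ 3` numeral (kind (ii) at a split place where `E(ℚ_w)[3] = 0`).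
[folklore] -/
theorem natCard_ker_nsmul_three_adicCompletion_le_three_of_checkAt_zero (hp3 : p ≠ 3)
    (hΔ : (⟨a₁, a₂, a₃, a₄, a₆⟩ : WeierstrassCurve ℤ).Δ ≠ 0) {k : ℕ}
    {cert : List (ℤ × ℕ × ℕ × ℕ)} (h : threeTorsionCheckAt p a₁ a₂ a₃ a₄ a₆ k cert = some 0)
    (W : WeierstrassCurve ℚ) (hW : W = ⟨a₁, a₂, a₃, a₄, a₆⟩)
    {v : HeightOneSpectrum (𝓞 ℚ)} (hv : (primesEquiv v : ℕ) = p) :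
    Nat.card (nsmulAddMonoidHom 3 : (W.baseChange (v.adicCompletion ℚ)).toAffine.Point →+
      (W.baseChange (v.adicCompletion ℚ)).toAffine.Point).ker ≤ 3 := by
  rw [natCard_ker_nsmul_three_adicCompletion_eq_of_checkAt p a₁ a₂ a₃ a₄ a₆ hp3 hΔ h W hW hv]
  norm_num

/-- **`integralModelInt` currency** (route-1 records): for `W/ℚ` globally minimal with integer
model `⟨a₁, …, a₆⟩`, a prime `p ≠ 3` and `threeTorsionCheckAt p a₁ … a₆ k cert = some S`,
`#ker([3] : E(ℚ_v)) = 1 + 2S` at the place `v` of `p`. [cite: SilvermanAEC2009, VII.3.1 and Ex. 3.7] -/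
theorem natCard_ker_nsmul_three_adicCompletion_eq_of_intModel_of_checkAt (hp3 : p ≠ 3)
    (W : WeierstrassCurve ℚ) [W.IsElliptic] [W.IsGloballyMinimal]
    (hI : W.integralModelInt = ⟨a₁, a₂, a₃, a₄, a₆⟩) {k S : ℕ} {cert : List (ℤ × ℕ × ℕ × ℕ)}
    (h : threeTorsionCheckAt p a₁ a₂ a₃ a₄ a₆ k cert = some S)
    {v : HeightOneSpectrum (𝓞 ℚ)} (hv : (primesEquiv v : ℕ) = p) :
    Nat.card (nsmulAddMonoidHom 3 : (W.baseChange (v.adicCompletion ℚ)).toAffine.Point →+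
      (W.baseChange (v.adicCompletion ℚ)).toAffine.Point).ker = 1 + 2 * S := by
  rw [natCard_ker_nsmul_adicCompletion_eq_natCard_torsion_padic _ v hv 3]
  exact natCard_threeTorsion_padic_eq_of_intModel_of_check p a₁ a₂ a₃ a₄ a₆ hp3 W hI h

end Bridge

/-! ### Two demo instances on r1's V40 list (the records file, if dealt, does the rest) -/

/-- **2718f1 at the place of 151** (rank-2 partner of 2718d1, Cremona–Mazur Table 1; non-split
`I₁` at `151`; Cremona model `[1, -1, 0, -99, 409]`): free kind (i) holds in the kernel —
`3 ∉ v` and `#ker([3] : E′(ℚ_v)) = 1`. Certificate `k = 1`, ball `(93, 0, 1)`, `w = 0` (non-square).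
[cite: Cremona2006, Table 1 (Cremona label 2718f1)] [cite: CremonaMazur2000, Table 1] -/
theorem free_kind_i_2718f1_at151 (E' : WeierstrassCurve ℚ) (hE' : E' = ⟨1, -1, 0, -99, 409⟩)
    {v : HeightOneSpectrum (𝓞 ℚ)} (hv : (primesEquiv v : ℕ) = 151) :
    ((3 : ℕ) : 𝓞 ℚ) ∉ v.asIdeal ∧
      Nat.card (nsmulAddMonoidHom 3 : (E'.baseChange (v.adicCompletion ℚ)).toAffine.Point →+
        (E'.baseChange (v.adicCompletion ℚ)).toAffine.Point).ker = 1 := by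
  haveI : Fact (Nat.Prime 151) := ⟨by norm_num⟩
  refine free_kind_i_of_checkAt 151 1 (-1) 0 (-99) 409 (by norm_num) (by decide +kernel)
    (k := 1) (cert := [((93 : ℤ), 0, 1, 0)]) (by decide +kernel) E' ?_ hv
  rw [hE']; ext <;> norm_num

/-- **6867e1 at the place of 7** (rank-0 curve, split multiplicative at `7 ≡ 1 (mod 3)`; Cremona
model `[0, 0, 1, -1623, -25169]`): `#ker([3] : E(ℚ_v)) ≤ 3` (exactly `3`) — the numeral of free
kind (ii). Certificate `k = 1`, ball `(5, 0, 1)`, `w = 0` (square).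
[cite: Cremona2006, Table 1 (Cremona label 6867e1)] -/
theorem kind_ii_numeral_6867e1_at7 (W : WeierstrassCurve ℚ) (hW : W = ⟨0, 0, 1, -1623, -25169⟩)
    {v : HeightOneSpectrum (𝓞 ℚ)} (hv : (primesEquiv v : ℕ) = 7) :
    Nat.card (nsmulAddMonoidHom 3 : (W.baseChange (v.adicCompletion ℚ)).toAffine.Point →+
      (W.baseChange (v.adicCompletion ℚ)).toAffine.Point).ker ≤ 3 := by
  haveI : Fact (Nat.Prime 7) := ⟨by norm_num⟩
  refine natCard_ker_nsmul_three_adicCompletion_le_three_of_checkAt 7 0 0 1 (-1623) (-25169)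
    (by norm_num) (by decide +kernel) (k := 1) (cert := [((5 : ℤ), 0, 1, 0)]) (by decide +kernel)
    W ?_ hv
  rw [hW]; ext <;> norm_num

end Summit.BirchSwinnertonDyer.Rank1Residual.GaloisImage.LocalTorsion3At

end
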